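import Summits.CriticalPhenomena.PercolationContinuityZ3.Theorems.PercNearOneGluingNoHeavyLowerTailSahiFreshCoinOrderFourAllSlots
import HarnessLib

/-!
# The two-slot fresh-coin step at order 4: exact identity, and positivity from the MERGED order-3 functional

Support file for the Sahi / hitting-event programme (seat `prim-l12-p5`,
    gen 15; `--supports stmt-CriticalPhenomena-4575`).
No definitions, no named facts,
    no sorries; standard axioms.  Companion of `…SahiFreshCoinOrderThree` / `…OrderFourAllSlots`.
Memo `run/shared/lean/prim/prim-l12/FROM-prim-l12-p5-g15-FCL-ORDER3-AND-FLOW-REDUCTION.md` §2.3.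

SETTING as in the companions: finite type `α`, probability weight `μ`, `{0,1}`-valued `a b d e` (four events,
    repetitions
allowed), `{0,1}`-valued `c` with `E(c·g) = E(c)E(g)` on sub-family products, `a ⊔ c = a + c − a·c`, `p = E(c)`.

**THEOREM (`sahiE4_or_twoSlots`, exact identity, every law).**
  `E₄(a⊔c, b⊔c, d, e) = (1−p)²·E₄(a,b,d,e) + p(1−p)·[2·E₃(ab, d, e) + (2 + E(āb̄))·E₂(d,e) + 2·E(āb̄de)] + 2p²·E₂(d,e)`,
`ā = 1 − a`.  The bracket is twice the first Bernstein coefficient `b₁`; its only term not controlled by the positivity of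
SUB-families is the functional `E₃(1_{A∩B}, 1_D, 1_E)` of the MERGED family.  (General order `k`, memo §2.3:
`2b₁ = (k−2)E_{k−1}(1_{A∩B}, rest) + (k−2)(k−3)E_{k−2}(rest) + Σ_C |C|!(|D|−1)^♯ E(āb̄Π_C f) E_D(rest)`.)

**COROLLARY (`sahiE4_freshCoin_nonneg_twoSlots`).**  If `E₄(a,b,d,e) ≥ 0`, `E₂(d,e) ≥ 0` and the merged `E₃(ab,d,e) ≥ 0`, then
`E₄(a⊔c, b⊔c, d, e) ≥ 0`.  For HITTING events the merged hypothesis is the tree theorem `E₃(up-set, hit, hit) ≥ 0`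
(`…SahiCylinderComplementsGeneral`,
    cube-flipped); for ABSTRACT laws it can fail — this is exactly the census counterexample to the
abstract fresh-coin lemma at `(order, slots) = (4, 2)` (`ttrl/coin/COIN.md` §9.2: `E₃(E₀∩E₁,E₂,E₃) = −1/100`,
    `Cov = 0`,
`E(āb̄de) = 0`, so `E₄(pushed) = (1/250)(1−p)² − (1/50)p(1−p) < 0` at `p = ½`). [this work]
-/

namespace Summit.CriticalPhenomena.PercolationContinuityZ3.Theorems

namespace SahiFreshCoinOrderFourTwoSlots

open Finset Literature.Combinatorics.Sahi2008 SahiFreshCoinOrderThree SahiFreshCoinOrderFour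

variable {α : Type*} [Fintype α]

/-- **Order-4 two-slot identity (pure algebra in the fifteen moments).** [this work] -/
theorem twoSlots_core (p ma mb md me mab mad mae mbd mbe mde mabd mabe made mbde mabde : ℝ) :
    6 * (mabde + p * (mde - mabde)) - 2 * ((ma + p * (1 - ma)) * (mbde + p * (mde - mbde)) + (mb + p * (1 - mb)) *
        (made + p * (mde - made)) + md * (mabe + p * (me - mabe)) + me * (mabd + p * (md - mabd))) + ((ma + p * (1 -
        ma)) * (mb + p * (1 - mb)) * mde + (ma + p * (1 - ma)) * md * (mbe + p * (me - mbe)) + (ma + p * (1 - ma)) *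
        me * (mbd + p * (md - mbd)) + (mb + p * (1 - mb)) * md * (mae + p * (me - mae)) + (mb + p * (1 - mb)) * me *
        (mad + p * (md - mad)) + md * me * (mab + p * (1 - mab))) - ((mab + p * (1 - mab)) * mde + (mad + p * (md -
        mad)) * (mbe + p * (me - mbe)) + (mae + p * (me - mae)) * (mbd + p * (md - mbd))) - (ma + p * (1 - ma)) *
        (mb + p * (1 - mb)) * md * me =
      (1 - p) ^ 2 * (6 * mabde - 2 * (ma * mbde + mb * made + md * mabe + me * mabd) + (ma * mb * mde + ma * md *
          mbe + ma * me * mbd + mb * md * mae + mb * me * mad + md * me * mab) - (mab * mde + mad * mbe + mae * mbd) -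
          ma * mb * md * me) + p * (1 - p) * (2 * (2 * mabde + mab * md * me - (mab * mde + md * mabe + me * mabd)) +
          (2 + (1 - ma - mb + mab)) * (mde - md * me) + 2 * (mde - made - mbde + mabde)) + 2 * p ^ 2 * (mde - md *
          me) := by
  ring

/-- **Two slots at order 4, every law (identity).**  With `p = E(c)`, `c` idempotent and independent of the sub-family products:
`E₄(a⊔c, b⊔c, d, e) = (1−p)²E₄ + p(1−p)[2E₃(ab,d,e) + (2 + E(āb̄))E₂(d,e) + 2E(āb̄de)] + 2p²E₂(d,e)`. [this work] -/
theorem sahiE4_or_twoSlots (μ : α → ℝ) (hμ1 : ∑ x, μ x = 1) (a b d e c : α → ℝ) (hc : ∀ x, c x = 0 ∨ c x = 1)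
    (hind : ∀ s : Finset (Fin 4), ex μ (c * ∏ i ∈ s, ![a, b, d, e] i) = ex μ c * ex μ (∏ i ∈ s, ![a, b, d, e] i)) :
    sahiE μ 4 ![a + c - a * c, b + c - b * c, d, e] =
      (1 - ex μ c) ^ 2 * sahiE μ 4 ![a, b, d, e] +
        ex μ c * (1 - ex μ c) *
          (2 * sahiE μ 3 ![a * b, d, e] + (2 + ex μ ((1 - a) * (1 - b))) * sahiE μ 2 ![d, e] +
            2 * ex μ ((1 - a) * (1 - b) * d * e)) +
        2 * ex μ c ^ 2 * sahiE μ 2 ![d, e] := by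
  obtain ⟨ia, ib, id, ie, iab, iad, iae, ibd, ibe, ide, iabd, iabe, iade, ibde,
      iabde⟩ := indep_unpack4 μ a b d e c hind
  have one : ex μ (1 : α → ℝ) = 1 := ex_one hμ1
  have qa : ex μ ((a + c - a * c)) = ex μ a + ex μ c * (1 - ex μ a) := by
    have hpt : (a + c - a * c) = a + (c - c * a) := by
      funext x; simp only [Pi.mul_apply, Pi.add_apply, Pi.sub_apply]
      rcases hc x with h | h <;> rw [h] <;> ring
    rw [hpt, ex_add, ex_sub, ia]; ring
  have qb : ex μ ((b + c - b * c)) = ex μ b + ex μ c * (1 - ex μ b) := by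
    have hpt : (b + c - b * c) = b + (c - c * b) := by
      funext x; simp only [Pi.mul_apply, Pi.add_apply, Pi.sub_apply]
      rcases hc x with h | h <;> rw [h] <;> ring
    rw [hpt, ex_add, ex_sub, ib]; ring
  have qab : ex μ ((a + c - a * c) * (b + c - b * c)) = ex μ (a * b) + ex μ c * (1 - ex μ (a * b)) := by
    have hpt : (a + c - a * c) * (b + c - b * c) = a * b + (c - c * (a * b)) := by
      funext x; simp only [Pi.mul_apply, Pi.add_apply, Pi.sub_apply]
      rcases hc x with h | h <;> rw [h] <;> ring
    rw [hpt, ex_add, ex_sub, iab]; ring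
  have qad : ex μ ((a + c - a * c) * d) = ex μ (a * d) + ex μ c * (ex μ d - ex μ (a * d)) := by
    have hpt : (a + c - a * c) * d = a * d + (c * d - c * (a * d)) := by
      funext x; simp only [Pi.mul_apply, Pi.add_apply, Pi.sub_apply]
      rcases hc x with h | h <;> rw [h] <;> ring
    rw [hpt, ex_add, ex_sub, iad, id]; ring
  have qae : ex μ ((a + c - a * c) * e) = ex μ (a * e) + ex μ c * (ex μ e - ex μ (a * e)) := by
    have hpt : (a + c - a * c) * e = a * e + (c * e - c * (a * e)) := by
      funext x; simp only [Pi.mul_apply, Pi.add_apply, Pi.sub_apply]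
      rcases hc x with h | h <;> rw [h] <;> ring
    rw [hpt, ex_add, ex_sub, iae, ie]; ring
  have qbd : ex μ ((b + c - b * c) * d) = ex μ (b * d) + ex μ c * (ex μ d - ex μ (b * d)) := by
    have hpt : (b + c - b * c) * d = b * d + (c * d - c * (b * d)) := by
      funext x; simp only [Pi.mul_apply, Pi.add_apply, Pi.sub_apply]
      rcases hc x with h | h <;> rw [h] <;> ring
    rw [hpt, ex_add, ex_sub, ibd, id]; ring
  have qbe : ex μ ((b + c - b * c) * e) = ex μ (b * e) + ex μ c * (ex μ e - ex μ (b * e)) := by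
    have hpt : (b + c - b * c) * e = b * e + (c * e - c * (b * e)) := by
      funext x; simp only [Pi.mul_apply, Pi.add_apply, Pi.sub_apply]
      rcases hc x with h | h <;> rw [h] <;> ring
    rw [hpt, ex_add, ex_sub, ibe, ie]; ring
  have qabd : ex μ ((a + c - a * c) * (b + c - b * c) * d) = ex μ (a * b * d) + ex μ c * (ex μ d - ex μ (a * b *
      d)) := by
    have hpt : (a + c - a * c) * (b + c - b * c) * d = a * b * d + (c * d - c * (a * b * d)) := by
      funext x; simp only [Pi.mul_apply, Pi.add_apply, Pi.sub_apply]
      rcases hc x with h | h <;> rw [h] <;> ring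
    rw [hpt, ex_add, ex_sub, iabd, id]; ring
  have qabe : ex μ ((a + c - a * c) * (b + c - b * c) * e) = ex μ (a * b * e) + ex μ c * (ex μ e - ex μ (a * b *
      e)) := by
    have hpt : (a + c - a * c) * (b + c - b * c) * e = a * b * e + (c * e - c * (a * b * e)) := by
      funext x; simp only [Pi.mul_apply, Pi.add_apply, Pi.sub_apply]
      rcases hc x with h | h <;> rw [h] <;> ring
    rw [hpt, ex_add, ex_sub, iabe, ie]; ring
  have qade : ex μ ((a + c - a * c) * d * e) = ex μ (a * d * e) + ex μ c * (ex μ (d * e) - ex μ (a * d * e)) := by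
    have hpt : (a + c - a * c) * d * e = a * d * e + (c * (d * e) - c * (a * d * e)) := by
      funext x; simp only [Pi.mul_apply, Pi.add_apply, Pi.sub_apply]
      rcases hc x with h | h <;> rw [h] <;> ring
    rw [hpt, ex_add, ex_sub, iade, ide]; ring
  have qbde : ex μ ((b + c - b * c) * d * e) = ex μ (b * d * e) + ex μ c * (ex μ (d * e) - ex μ (b * d * e)) := by
    have hpt : (b + c - b * c) * d * e = b * d * e + (c * (d * e) - c * (b * d * e)) := by
      funext x; simp only [Pi.mul_apply, Pi.add_apply, Pi.sub_apply]
      rcases hc x with h | h <;> rw [h] <;> ring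
    rw [hpt, ex_add, ex_sub, ibde, ide]; ring
  have qabde : ex μ ((a + c - a * c) * (b + c - b * c) * d * e) = ex μ (a * b * d * e) + ex μ c * (ex μ (d * e) -
      ex μ (a * b * d * e)) := by
    have hpt : (a + c - a * c) * (b + c - b * c) * d * e = a * b * d * e + (c * (d * e) - c * (a * b * d * e)) := by
      funext x; simp only [Pi.mul_apply, Pi.add_apply, Pi.sub_apply]
      rcases hc x with h | h <;> rw [h] <;> ring
    rw [hpt, ex_add, ex_sub, iabde, ide]; ring
  have g12 : ex μ ((1 - a) * (1 - b)) = 1 - ex μ a - ex μ b + ex μ (a * b) := by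
    have : (1 - a) * (1 - b) = 1 - a - b + a * b := by
      funext x; simp only [Pi.mul_apply, Pi.add_apply, Pi.sub_apply, Pi.one_apply]; ring
    rw [this, ex_add, ex_sub, ex_sub, one]
  have g12de : ex μ ((1 - a) * (1 - b) * d * e) =
      ex μ (d * e) - ex μ (a * d * e) - ex μ (b * d * e) + ex μ (a * b * d * e) := by
    have : (1 - a) * (1 - b) * d * e = d * e - a * d * e - b * d * e + a * b * d * e := by
      funext x; simp only [Pi.mul_apply, Pi.add_apply, Pi.sub_apply, Pi.one_apply]; ring
    rw [this, ex_add, ex_sub, ex_sub]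
  rw [sahiE_four, sahiE_four, sahiE_three, sahiE_two]
  rw [qabde, qabd, qabe, qade, qbde, qab, qad, qae, qbd, qbe, qa, qb, g12, g12de]
  ring

/-- **FCL, order 4, two slots — positivity from the merged functional.**  If `E₄(a,b,d,e) ≥ 0`, `E₂(d,e) ≥ 0` and the MERGED
`E₃(ab, d, e) ≥ 0`, then `E₄(a ⊔ c, b ⊔ c, d, e) ≥ 0` for an independent `{0,1}`-valued `c`.  (For hitting events the merged
hypothesis is the tree theorem `E₃(up-set, hit, hit) ≥ 0`; for abstract laws it can fail,
    census `COIN.md` §9.2.) [this work] -/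
theorem sahiE4_freshCoin_nonneg_twoSlots (μ : α → ℝ) (hμ : ∀ x, 0 ≤ μ x) (hμ1 : ∑ x, μ x = 1) (a b d e c : α → ℝ)
    (ha : ∀ x, a x = 0 ∨ a x = 1) (hb : ∀ x, b x = 0 ∨ b x = 1) (hd : ∀ x, d x = 0 ∨ d x = 1)
    (he : ∀ x, e x = 0 ∨ e x = 1) (hc : ∀ x, c x = 0 ∨ c x = 1)
    (hind : ∀ s : Finset (Fin 4), ex μ (c * ∏ i ∈ s, ![a, b, d, e] i) = ex μ c * ex μ (∏ i ∈ s, ![a, b, d, e] i))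
    (hE4 : 0 ≤ sahiE μ 4 ![a, b, d, e]) (hE2 : 0 ≤ sahiE μ 2 ![d, e]) (hE3 : 0 ≤ sahiE μ 3 ![a * b, d, e]) :
    0 ≤ sahiE μ 4 ![a + c - a * c, b + c - b * c, d, e] := by
  rw [sahiE4_or_twoSlots μ hμ1 a b d e c hc hind]
  have hp := ex_zeroOne_mem hμ hμ1 hc
  have pa := fun x => zeroOne_bounds ha x
  have pb := fun x => zeroOne_bounds hb x
  have pd := fun x => zeroOne_bounds hd x
  have pe := fun x => zeroOne_bounds he x
  have hnn : 0 ≤ ex μ ((1 - a) * (1 - b)) := ex_nonneg hμ fun x => by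
    simp only [Pi.mul_apply, Pi.sub_apply, Pi.one_apply]
    exact mul_nonneg (by linarith [(pa x).2]) (by linarith [(pb x).2])
  have hnnde : 0 ≤ ex μ ((1 - a) * (1 - b) * d * e) := ex_nonneg hμ fun x => by
    simp only [Pi.mul_apply, Pi.sub_apply, Pi.one_apply]
    exact mul_nonneg (mul_nonneg (mul_nonneg (by linarith [(pa x).2]) (by linarith [(pb x).2])) (pd x).1) (pe x).1
  have hq : 0 ≤ 1 - ex μ c := by linarith [hp.2]
  have h1 : 0 ≤ (1 - ex μ c) ^ 2 * sahiE μ 4 ![a, b, d, e] := mul_nonneg (sq_nonneg _) hE4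
  have h2 : 0 ≤ ex μ c * (1 - ex μ c) *
      (2 * sahiE μ 3 ![a * b, d, e] + (2 + ex μ ((1 - a) * (1 - b))) * sahiE μ 2 ![d, e] +
        2 * ex μ ((1 - a) * (1 - b) * d * e)) := by
    refine mul_nonneg (mul_nonneg hp.1 hq) ?_
    have : 0 ≤ (2 + ex μ ((1 - a) * (1 - b))) * sahiE μ 2 ![d, e] := mul_nonneg (by linarith) hE2
    linarith [mul_nonneg (show (0:ℝ) ≤ 2 by norm_num) hE3, mul_nonneg (show (0:ℝ) ≤ 2 by norm_num) hnnde]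
  have h3 : 0 ≤ 2 * ex μ c ^ 2 * sahiE μ 2 ![d, e] := mul_nonneg (mul_nonneg (by norm_num) (sq_nonneg _)) hE2
  linarith

end SahiFreshCoinOrderFourTwoSlots

end Summit.CriticalPhenomena.PercolationContinuityZ3.Theorems
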